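import Summits.Ventures.PercRepro.Night2FatZLoads

/-!
# night-2: the DEGENERATE two-planes regime — the planes of a distance-2 source off the spine

When the points `M` of `π₃` off the spine are collinear, a distance-2 line `R ⊆ π₂` off the spine becomes possible
(`rkN_off_le_two_of_line_of_source_planes` is exactly the obstruction).  Its source's planes are forced:
* **`source_planes_of_line_off_spine`**: one of them is `π₂` (it contains `R ∪ R₁`), the other contains every point of
  `H₀` off `π₂` — so `rk (R ∪ M) ≤ 3`: `R` is COPLANAR with the line of `M`;
* **`subset_clF_of_coplanar_of_class`**: if moreover `M ∪ {w₀, x}` has rank `4` (the line of `M` is not a class line), every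
  such `R` lies in the rank-`4` flat `Φ = clF (M ∪ {w₀, x})`, hence in `Φ ∩ π₂`, which has rank `≤ 2`
  (**`rkN_inter_le_two_of_not_class`**): there is at most ONE such line.
These are the geometric inputs of the degenerate regime (paper `proofs/NIGHT-2-g34.md` §6′ (d)); its count is the
successor's.
-/

namespace PercRepro.Shadow

open PercRepro.ThmH PercRepro.PerFlat

variable {α : Type*} [DecidableEq α] {M : Matroid α} [M.Finite] {G : Finset α}

/-- **The source planes of a distance-2 line off the spine inside `π₂`**: one of them is `π₂` and the other contains
every point of `S` (the points of `H₀` outside `π₂`); in particular `rk (R ∪ S) ≤ 3`. -/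
theorem source_planes_of_line_off_spine (hs : ∀ e ∈ gr M, ∀ f ∈ gr M, e ≠ f → rkN M {e, f} = 2)
    {R₁ : Finset α} (hR₁g : R₁ ⊆ gr M) (hR₁2 : rkN M R₁ = 2) (hR₁3 : 3 ≤ R₁.card) {c₂ : α}
    (hc₂g : c₂ ∈ gr M) (hc₂ : c₂ ∉ clF M R₁) {R : Finset α} (hRg : R ⊆ gr M) (hR2 : rkN M R = 2)
    (hRπ : R ⊆ clF M (insert c₂ R₁)) {r : α} (hrR : r ∈ R) (hrL : r ∉ clF M R₁) {c₂' c₃' : α}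
    (hc₂'g : c₂' ∈ gr M) (hc₃'g : c₃' ∈ gr M) (hc₂' : c₂' ∉ clF M R) (hc₃' : c₃' ∉ clF M (insert c₂' R))
    {S : Finset α} (hS : ∀ e ∈ S, e ∉ clF M (insert c₂ R₁))
    (hScover : ∀ e ∈ S, e ∈ clF M (insert c₂' R) ∨ e ∈ clF M (insert c₃' R))
    (hR₁cover : ∀ e ∈ R₁, e ∈ clF M (insert c₂' R) ∨ e ∈ clF M (insert c₃' R)) :
    rkN M (R ∪ S) ≤ 3 := by
  have hπ₂ : rkN M (insert c₂ R₁) = 3 := by rw [rkN_insert_of_notMem_clF hc₂g hc₂, hR₁2]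
  have hπ₂g : insert c₂ R₁ ⊆ gr M := Finset.insert_subset hc₂g hR₁g
  have hRR₁ : R₁ ∪ R ⊆ clF M (insert c₂ R₁) :=
    Finset.union_subset ((subset_clF_of_subset_gr hR₁g).trans (clF_mono (Finset.subset_insert _ _))) hRπ
  have hrk3 : 3 ≤ rkN M (R₁ ∪ R) := by
    have h1 : rkN M (insert r R₁) = 3 := by rw [rkN_insert_of_notMem_clF (hRg hrR) hrL, hR₁2]
    have hsub : insert r R₁ ⊆ R₁ ∪ R :=
      Finset.insert_subset (Finset.mem_union_right _ hrR) Finset.subset_union_left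
    have h2 := rkN_mono (M := M) hsub
    omega
  have hclπ₂ : clF M (R₁ ∪ R) = clF M (insert c₂ R₁) :=
    clF_eq_clF_of_subset_clF_of_rkN_le hπ₂g hRR₁ (by omega)
  have key : ∀ u v : α, u ∈ gr M → v ∈ gr M → u ∉ clF M R → v ∉ clF M (insert u R) →
      R₁ ⊆ clF M (insert u R) → (∀ e ∈ S, e ∈ clF M (insert u R) ∨ e ∈ clF M (insert v R)) →
      rkN M (R ∪ S) ≤ 3 := by
    intro u v hug hvg hu hv hR₁σ hSc
    have hσ : rkN M (insert u R) = 3 := by rw [rkN_insert_of_notMem_clF hug hu, hR2]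
    have hσg : insert u R ⊆ gr M := Finset.insert_subset hug hRg
    have hRR₁σ : R₁ ∪ R ⊆ clF M (insert u R) :=
      Finset.union_subset hR₁σ ((subset_clF_of_subset_gr hRg).trans (clF_mono (Finset.subset_insert _ _)))
    have hclσ : clF M (R₁ ∪ R) = clF M (insert u R) :=
      clF_eq_clF_of_subset_clF_of_rkN_le hσg hRR₁σ (by omega)
    have hSτ : S ⊆ clF M (insert v R) := by
      intro e he
      rcases hSc e he with h' | h'
      · exfalso
        rw [← hclσ, hclπ₂] at h'
        exact hS e he h'
      · exact h'
    have hv' : v ∉ clF M R := fun h' => hv (clF_mono (Finset.subset_insert _ _) h')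
    have hτ : rkN M (insert v R) = 3 := by rw [rkN_insert_of_notMem_clF hvg hv', hR2]
    have hsub : R ∪ S ⊆ clF M (insert v R) :=
      Finset.union_subset ((subset_clF_of_subset_gr hRg).trans (clF_mono (Finset.subset_insert _ _))) hSτ
    have := rkN_mono (M := M) hsub
    rw [rkN_clF, hτ] at this
    exact this
  rcases subset_plane_of_rkN_le_two_of_cover hs hR₁g (by omega) hR₁3 hR₁cover with h2 | h3
  · exact key c₂' c₃' hc₂'g hc₃'g hc₂' hc₃' h2 hScover
  · have hc₂'' : c₂' ∉ clF M (insert c₃' R) :=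
      notMem_clF_insert_of_notMem_clF_insert hRg hc₂'g hc₃'g hc₂' hc₃'
    have hc₃'R : c₃' ∉ clF M R := fun h' => hc₃' (clF_mono (Finset.subset_insert _ _) h')
    exact key c₃' c₂' hc₃'g hc₂'g hc₃'R hc₂'' h3 (fun e he => (hScover e he).symm)

/-- **A class line coplanar with a set `S` whose span with the off-points has rank `4` lies in that span**:
`R ⊆ clF (S ∪ {w₀, x})`. -/
theorem subset_clF_of_coplanar_of_class {w₀ x : α} (hw₀g : w₀ ∈ gr M) (hxg : x ∈ gr M) {S : Finset α}
    (hSg : S ⊆ gr M) (hS4 : rkN M (S ∪ {w₀, x}) = 4) {R : Finset α} (hRg : R ⊆ gr M) (hR2 : rkN M R = 2)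
    (hRc : rkN M (insert w₀ (insert x R)) ≤ 3) (hRS : rkN M (R ∪ S) ≤ 3) : R ⊆ clF M (S ∪ {w₀, x}) := by
  have hSig : insert w₀ (insert x R) ⊆ gr M := Finset.insert_subset hw₀g (Finset.insert_subset hxg hRg)
  have hPig : R ∪ S ⊆ gr M := Finset.union_subset hRg hSg
  have hmod := rkN_inter_clF_add_le hSig hPig
  have hRint : R ⊆ clF M (insert w₀ (insert x R)) ∩ clF M (R ∪ S) := by
    intro e he
    rw [Finset.mem_inter]
    exact ⟨subset_clF_of_subset_gr hSig (Finset.mem_insert_of_mem (Finset.mem_insert_of_mem he)),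
      subset_clF_of_subset_gr hPig (Finset.mem_union_left _ he)⟩
  have h2 := rkN_mono (M := M) hRint
  -- the union of the two planes has rank at most 4 and contains `S ∪ {w₀, x}` of rank 4
  have hU : insert w₀ (insert x R) ∪ (R ∪ S) ⊆ gr M := Finset.union_subset hSig hPig
  have hsub : S ∪ {w₀, x} ⊆ insert w₀ (insert x R) ∪ (R ∪ S) := by
    intro e he
    rw [Finset.mem_union, Finset.mem_insert, Finset.mem_singleton] at he
    rw [Finset.mem_union, Finset.mem_insert, Finset.mem_insert, Finset.mem_union]
    rcases he with he | rfl | rfl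
    · exact Or.inr (Or.inr he)
    · exact Or.inl (Or.inl rfl)
    · exact Or.inl (Or.inr (Or.inl rfl))
  have hrkU : rkN M (insert w₀ (insert x R) ∪ (R ∪ S)) ≤ 4 := by omega
  have hSU : S ∪ {w₀, x} ⊆ gr M := Finset.union_subset hSg (by
    intro e he
    rw [Finset.mem_insert, Finset.mem_singleton] at he
    rcases he with rfl | rfl
    · exact hw₀g
    · exact hxg)
  have hcl : clF M (S ∪ {w₀, x}) = clF M (insert w₀ (insert x R) ∪ (R ∪ S)) :=
    clF_eq_clF_of_subset_clF_of_rkN_le hU (hsub.trans (subset_clF_of_subset_gr hU)) (by rw [hS4]; exact hrkU)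
  rw [hcl]
  exact fun e he => subset_clF_of_subset_gr hU (Finset.mem_union_left _ (Finset.mem_insert_of_mem (Finset.mem_insert_of_mem he)))

/-- **The rank-`4` flat `clF (S ∪ {w₀, x})` meets a plane `clF (insert c₂ R₁)` of `H₀` in rank `≤ 2`** when the two
together span `V` (rank `5`): at most one distance-2 line off the spine in the degenerate regime with a non-class `M`. -/
theorem rkN_inter_le_two_of_not_class {w₀ x : α} (hw₀g : w₀ ∈ gr M) (hxg : x ∈ gr M) {S : Finset α}
    (hSg : S ⊆ gr M) (hS4 : rkN M (S ∪ {w₀, x}) = 4) {P : Finset α} (hPg : P ⊆ gr M) (hP3 : rkN M P = 3)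
    (h5 : 5 ≤ rkN M (S ∪ {w₀, x} ∪ P)) : rkN M (clF M (S ∪ {w₀, x}) ∩ clF M P) ≤ 2 := by
  have hSU : S ∪ {w₀, x} ⊆ gr M := Finset.union_subset hSg (by
    intro e he
    rw [Finset.mem_insert, Finset.mem_singleton] at he
    rcases he with rfl | rfl
    · exact hw₀g
    · exact hxg)
  have hmod := rkN_inter_clF_add_le hSU hPg
  omega

end PercRepro.Shadow
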